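import Summits.ABC.IUTFork.Cor312LicenceTripleHullCellRefuteTameSharp
import Summits.ABC.IUTFork.Cor312LicenceTripleHullCellRefute
import Summits.ABC.IUTFork.Conditional.RefBandsExactCellLinear
import Summits.ABC.IUTFork.Conditional.AbcOfSGenuineKLinUniformRows4
import HarnessLib

/-!
# R-W «W:REF-BANDS-EXACT», PER-TYPE band (TYPE-SPLIT pole): the triple `5 ^ 14 * 19 + 2 ^ 5 * 3 * 7 ^ 13 = 11 ^ 7 * 37 ^ 2 * 353` — S_H REFUTED at EVERY genuine Θ-volume datum over
# `(ratPoint (a/c), l)` whose fibre over `p = 7` has the LOWER local type `e ∣ 15·l`, for EVERY prime `7 ≤ l ≤ 11735`, `l ≠ 7`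

PROOF-ONLY file (D-0012: 0 definitions, 0 `Prop` facts, no instance, no notation) of the abc-iut cell — D-0079 RESCUE sub-cell R-W «WINDOW Θ-SIDE
INEQUALITY», numerics-crew seat abc-iut-W-num-6 (gen 4), row «W:REF-BANDS-EXACT» (abc-iut-plan g11 C-R84 (b) / C-R88 (a)), answering the R-W numerics lead's
ROUTING MAP HOME/plan/rescue/R-W/TS-BANDS.tsv c7a7f5743650f576 (2026-08-27T05:21:49Z): at the TYPE-SPLIT pole `p = 7` (`p ∣ ab`, `v = v_p(abc) = 13` odd or
`3/5`-divisible, kernel class `{15, 30}` by abc-iut-W-neg-1 g4's `WRow.localType_class_triple_sharp`) the ∀T band of this seat's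
`Conditional/RefBandsExact115966796875.lean` stops where the UPPER member's certificate stops, while the LOWER member `A = 15` stays refuted much longer. GENERATED by
HOME/abc-iut-W-num-6/refbands/emit_typeband.py (closed form of CLOSED-FORMS.tsv / BAND-PLAN.tsv; member `A = 15` pieces: a₀ = 2 on [5,19] («-600·l < -2922», (α,β) = (105,-191)), a₀ = 3 on [20,137] («-420·l < 606», (α,β) = (75,88)), a₀ = 4 on [138,960] («-240·l < 25302», (α,β) = (45,2131)), a₀ = 5 on [961,6722] («-60·l < 198174», (α,β) = (15,16522)), a₀ = 6 on [6723,11735] («120·l < 1408278», (α,β) = (-15,117349)); end 11735).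
Shape of abc-iut-w5-d009 g14's «W:GAP-1019» per-type theorems (`WRowFrey37569208117Gap1657`, p497503), uniform in `l`: the sub-class hypothesis
`hloc : ∀ x₀ ∣ 7, e(K_x₀/ℚ_7) ∣ 15·l` is sharpened to `e = 15·l` by the class lemma, and w5-d009's PINNED socket
`WRow.not_licence_triple_of_not_hullCell` (`Cor312LicenceTripleHullCellRefute`, p493429) fires with this seat's linear cells `RefBand.not_hullCell_of_linear'` (p496042).
* `RefBand.typecells_115966796875_fifteen` — the pinned socket's integer inputs for `A = 15` (turning point, failing top-label cell), piecewise linear;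
* `WRow.not_licence_triple_115966796875_typeband_of_fifteen` — licence shape (every analytic `logv`, every realising idele pair);
* **`GenuineK.not_pilotKummerCompatHull_chosen_triple_115966796875_typeband_of_fifteen`** — the W-lane row shape (chosen ideles, pinned reading, every free binder).
HONEST SCOPE: a PER-TYPE statement — it binds the local type at `p = 7` (the other member of the class is NOT refuted on this range by this route; the R-W
lead's desk reads it INHABITED there as typed); SHARP reading; per-label licence STRONGER than print; admissibility / Szpiro-badness / (P6) and non-emptiness of the
datum type (and of the sub-class) NOT claimed; «refuted as typed» ≠ «refuted in print»; nothing about the number-level `Cor22.Cor312AtDatum`; typed ≠ proved;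
no abc claim. [cite: Mochizuki2012, IUTchI Ex. 3.2 (iv) p. 71; IUTchIII Cor. 3.12 Step (xi-f) p. 184; IUTchIV Prop. 1.1 p. 9, Prop. 1.2 (i)(ii) p. 10, Cor. 2.2 (ii) proof (P5) p. 46]
[cite: DupuyHilado2025, §3.4, §4.9, §4.12] [cite: SerreLocalFields1979, Ch. III §6 Prop. 13] [claim: Mochizuki2012, status: disputed] for every IUT sentence quoted.
-/

noncomputable section

open Set Function NumberField IsDedekindDomain

namespace Summit.ABC.IUTFork.Conditional

open Thm311 Thm311.Real Cor312 Cor312Vol Cor312Prov Literature.IUT.LogThetaLattice Literature.IUT.LogVolume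
  Literature.IUT.HodgeTheaters Literature.IUT.LogVolume.ThetaData Literature.IUT.LogVolume.Cor22
open Literature.NumberTheory.NumberFields Literature.NumberTheory.GaloisRepresentations.Ultrametric
open Literature.NumberTheory.DiophantineGeometry Literature.NumberTheory.DiophantineGeometry.GenEll Summit.ABC.ABC.Theorems
open Summit.ABC.IUTFork.Repair.RH.HullThresholdExact Summit.ABC.IUTFork.Repair.RH.HullThresholdExactRefute


/-- **The pinned socket's integer inputs for the member `A = 15` (pole `p = 7`, `v = 13`), every odd `7 ≤ l ≤ 11735`, top label `i + 1 = l⋆`:**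
turning point `a₀` and the failing top-label cell, piece by piece, by `RefBand.not_hullCell_of_linear'`. [folklore] -/
theorem RefBand.typecells_115966796875_fifteen {l : ℕ} (hlo : 7 ≤ l) (hhi : l ≤ 11735) (hodd : Odd l) {i : ℕ} (hi : i + 1 = (l - 1) / 2) :
    ∃ a₀ : ℕ, (∀ s : ℕ, s < a₀ → (1 : ℤ) * ((7 : ℕ) : ℤ) ^ s * (((7 : ℕ) : ℤ) - 1) < ((15 * l : ℕ) : ℤ)) ∧
      ((15 * l : ℕ) : ℤ) ≤ 1 * ((7 : ℕ) : ℤ) ^ a₀ * (((7 : ℕ) : ℤ) - 1) ∧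
      ¬ HullCell ((15 * l : ℕ) : ℤ) ((15 * 13 : ℕ) : ℤ) ((i : ℤ) + 1) (((15 * l) / ((7 : ℕ) - 1) + 1 : ℕ) : ℤ)
        (((7 : ℕ) : ℤ) ^ a₀ - (a₀ : ℤ) * ((15 * l : ℕ) : ℤ)) := by
  obtain ⟨j, hj⟩ := hodd
  have hij : (i : ℤ) + 1 = (j : ℤ) := by
    have : i + 1 = j := by omega
    exact_mod_cast this
  have hlj : (l : ℤ) = 2 * (j : ℤ) + 1 := by exact_mod_cast hj
  have hcast : (((15 * l) / ((7 : ℕ) - 1) + 1 : ℕ) : ℤ) = (15 : ℤ) * (l : ℤ) / ((7 : ℤ) - 1) + 1 := by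
    push_cast [Int.natCast_div]
    norm_num
  by_cases h0 : l ≤ 19
  · refine ⟨2, fun s hs => ?_, ?_, ?_⟩
    · interval_cases s <;> push_cast <;> omega
    · push_cast; omega
    · rw [hij, hcast]
      have h := RefBand.not_hullCell_of_linear' (ev := 15) (v := 13) (p := 7) (a := 2) (pa := 49) (l := (l : ℤ)) (j := (j : ℤ))
        (e := ((15 * l : ℕ) : ℤ)) (m := ((15 * 13 : ℕ) : ℤ)) (by norm_num) (by norm_num) (by positivity) hlj (by push_cast; ring)
        (by norm_num) (by push_cast; omega)
      simpa using h
  · have h0' : 19 < l := by omega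
    by_cases h1 : l ≤ 137
    · refine ⟨3, fun s hs => ?_, ?_, ?_⟩
      · interval_cases s <;> push_cast <;> omega
      · push_cast; omega
      · rw [hij, hcast]
        have h := RefBand.not_hullCell_of_linear' (ev := 15) (v := 13) (p := 7) (a := 3) (pa := 343) (l := (l : ℤ)) (j := (j : ℤ))
          (e := ((15 * l : ℕ) : ℤ)) (m := ((15 * 13 : ℕ) : ℤ)) (by norm_num) (by norm_num) (by positivity) hlj (by push_cast; ring)
          (by norm_num) (by push_cast; omega)
        simpa using h
    · have h1' : 137 < l := by omega
      by_cases h2 : l ≤ 960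
      · refine ⟨4, fun s hs => ?_, ?_, ?_⟩
        · interval_cases s <;> push_cast <;> omega
        · push_cast; omega
        · rw [hij, hcast]
          have h := RefBand.not_hullCell_of_linear' (ev := 15) (v := 13) (p := 7) (a := 4) (pa := 2401) (l := (l : ℤ)) (j := (j : ℤ))
            (e := ((15 * l : ℕ) : ℤ)) (m := ((15 * 13 : ℕ) : ℤ)) (by norm_num) (by norm_num) (by positivity) hlj (by push_cast; ring)
            (by norm_num) (by push_cast; omega)
          simpa using h
      · have h2' : 960 < l := by omega
        by_cases h3 : l ≤ 6722
        · refine ⟨5, fun s hs => ?_, ?_, ?_⟩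
          · interval_cases s <;> push_cast <;> omega
          · push_cast; omega
          · rw [hij, hcast]
            have h := RefBand.not_hullCell_of_linear' (ev := 15) (v := 13) (p := 7) (a := 5) (pa := 16807) (l := (l : ℤ)) (j := (j : ℤ))
              (e := ((15 * l : ℕ) : ℤ)) (m := ((15 * 13 : ℕ) : ℤ)) (by norm_num) (by norm_num) (by positivity) hlj (by push_cast; ring)
              (by norm_num) (by push_cast; omega)
            simpa using h
        · have h3' : 6722 < l := by omega
          refine ⟨6, fun s hs => ?_, ?_, ?_⟩
          · interval_cases s <;> push_cast <;> omega
          · push_cast; omega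
          · rw [hij, hcast]
            have h := RefBand.not_hullCell_of_linear' (ev := 15) (v := 13) (p := 7) (a := 6) (pa := 117649) (l := (l : ℤ)) (j := (j : ℤ))
              (e := ((15 * l : ℕ) : ℤ)) (m := ((15 * 13 : ℕ) : ℤ)) (by norm_num) (by norm_num) (by positivity) hlj (by push_cast; ring)
              (by norm_num) (by push_cast; omega)
            simpa using h

/-- **PER-TYPE REF band, licence shape: the triple `5 ^ 14 * 19 + 2 ^ 5 * 3 * 7 ^ 13 = 11 ^ 7 * 37 ^ 2 * 353`, sub-class `e(·∣7) ∣ 15·l`, every prime `7 ≤ l ≤ 11735`, `l ≠ 7`.**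
For every such `l`, EVERY genuine Θ-volume datum `T` over `(ratPoint (a/c), l)` whose fibre points over `7` have `e(K_x₀/ℚ_7) ∣ 15·l`, every analytic
`logv` and every pair of realising Θ- and q-ideles: `¬ Thm311ToCor312.Licence (settingPrVolSharp (pilotDataOfK T.D T.K) …)`. The class lemma makes `e = 15·l`
exact; `P_q = 195`; the integer inputs are `RefBand.typecells_115966796875_fifteen`.
[cite: Mochizuki2012, IUTchIII Cor. 3.12 Step (xi-f) p. 184; IUTchIV Prop. 1.1 p. 9, Prop. 1.2 (i)(ii) p. 10] [claim: Mochizuki2012, status: disputed] -/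
theorem WRow.not_licence_triple_115966796875_typeband_of_fifteen {l : ℕ} (hl : l.Prime) (hlo : 7 ≤ l) (hhi : l ≤ 11735) (hne : l ≠ 7)
    (T : Cor22.ThetaVolumeDatumAt (ratPoint (((5 ^ 14 * 19 : ℕ) : ℚ) / (11 ^ 7 * 37 ^ 2 * 353 : ℕ))) l)
    (hloc : letI := T.instFieldF; letI := T.instNumberFieldF; letI := T.instAlgebraF; letI := T.instFieldK
      letI := T.instNumberFieldK; letI := T.instAlgebraK; letI := T.instFieldFbar; letI := T.instAlgebraFbar
      letI := T.instAlgebraKFbar; letI := T.instIsElliptic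
      haveI : Fact (Nat.Prime 7) := ⟨by norm_num⟩
      ∀ x₀ : (thetaIndex (pilotDataOfK T.D T.K)).Fibre (.inr ⟨7, by norm_num⟩),
        absRamificationIdx 7 (kOf (pilotDataOfK T.D T.K) 7 x₀) ∣ 15 * l) :
    letI := T.instFieldF; letI := T.instNumberFieldF; letI := T.instAlgebraF; letI := T.instFieldK
    letI := T.instNumberFieldK; letI := T.instAlgebraK; letI := T.instFieldFbar; letI := T.instAlgebraFbar
    letI := T.instAlgebraKFbar; letI := T.instIsElliptic
    ∀ {logv : PadicLogs T.K} (hlog : LogvAnalytic logv) (M : Type) [Field M] [NumberField M]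
      (archPk : ∀ (j : (thetaIndex (pilotDataOfK T.D T.K)).Label) (vQ : (thetaIndex (pilotDataOfK T.D T.K)).VQ),
        Set ((logShellsDH (pilotDataOfK T.D T.K) logv).Packet j vQ))
      (archSub : ∀ (j : (thetaIndex (pilotDataOfK T.D T.K)).Label) (v : (thetaIndex (pilotDataOfK T.D T.K)).V),
        Set ((logShellsDH (pilotDataOfK T.D T.K) logv).Packet j ((thetaIndex (pilotDataOfK T.D T.K)).over v)))
      (Ψ : ℤ → ∀ v : (thetaIndex (pilotDataOfK T.D T.K)).V, v ∈ (thetaIndex (pilotDataOfK T.D T.K)).Vbad →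
        Set ((logShellsDH (pilotDataOfK T.D T.K) logv).StarPacket v))
      (act : ℤ → ∀ v : (thetaIndex (pilotDataOfK T.D T.K)).V, v ∈ (thetaIndex (pilotDataOfK T.D T.K)).Vbad →
        (logShellsDH (pilotDataOfK T.D T.K) logv).StarPacket v → Module.End ℚ ((logShellsDH (pilotDataOfK T.D T.K) logv).StarPacket v))
      (Mmod : ℤ → ∀ j : (thetaIndex (pilotDataOfK T.D T.K)).LabelStar, Set ((logShellsDH (pilotDataOfK T.D T.K) logv).GlobalPacket j.1))
      (region : ℤ → ∀ j : (thetaIndex (pilotDataOfK T.D T.K)).LabelStar, FinDivisor M → ∀ vQ : (thetaIndex (pilotDataOfK T.D T.K)).VQ,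
        Set ((logShellsDH (pilotDataOfK T.D T.K) logv).Packet j.1 vQ))
      (n : ℤ) {HT : Type} {LogLink : HT → HT → Type} {IsFull : ∀ {s t : HT}, LogLink s t → Prop}
      (lat : LGPGaussianLogThetaLattice LogLink IsFull)
      {Frd : Type} {IsoF : Frd → Frd → Type} {Ob : Frd → Type} {realify : Frd → Frd} {Strip : Type}
      {IsoS : Strip → Strip → Type} {Mv : ∀ v : (thetaIndex (pilotDataOfK T.D T.K)).V, v ∈ (thetaIndex (pilotDataOfK T.D T.K)).Vbad → Type}
      [∀ v h, Monoid (Mv v h)]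
      (sig : GlobalLGPFrobenioidSignature (thetaIndex (pilotDataOfK T.D T.K)).lstar (thetaIndex (pilotDataOfK T.D T.K)).V
        (· ∈ (thetaIndex (pilotDataOfK T.D T.K)).Vbad) Frd IsoF Ob realify Strip IsoS Mv)
      (split : SplittingMonoids Mv) {ObΔ : Type} {N : ∀ v : (thetaIndex (pilotDataOfK T.D T.K)).V, v ∈ (thetaIndex (pilotDataOfK T.D T.K)).Vbad → Type}
      [∀ v h, Monoid (N v h)] (qData : QPilotData ObΔ N)
      (tq : ∀ (pp : Nat.Primes) (x : (thetaIndex (pilotDataOfK T.D T.K)).Fibre (.inr pp)),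
        haveI : Fact (pp : ℕ).Prime := ⟨pp.2⟩; kOf (pilotDataOfK T.D T.K) pp.1 x)
      (t : ∀ (pp : Nat.Primes) (_ : Fin (pilotDataOfK T.D T.K).lstar) (x : (thetaIndex (pilotDataOfK T.D T.K)).Fibre (.inr pp)),
        haveI : Fact (pp : ℕ).Prime := ⟨pp.2⟩; kOf (pilotDataOfK T.D T.K) pp.1 x)
      (htq0 : ∀ pp x, tq pp x ≠ 0)
      (htq1 : ∀ (pp : Nat.Primes) (x : (thetaIndex (pilotDataOfK T.D T.K)).Fibre (.inr pp)),
        haveI : Fact (pp : ℕ).Prime := ⟨pp.2⟩; placeOf (pilotDataOfK T.D T.K) pp.1 x ∉ (pilotDataOfK T.D T.K).S → ‖tq pp x‖ = 1)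
      (_ht0 : ∀ pp i x, t pp i x ≠ 0)
      (_ht : ∀ (pp : Nat.Primes) (i : Fin (pilotDataOfK T.D T.K).lstar) (x : (thetaIndex (pilotDataOfK T.D T.K)).Fibre (.inr pp)),
        haveI : Fact (pp : ℕ).Prime := ⟨pp.2⟩
        Real.log ‖t pp i x‖ = -((pilotDataOfK T.D T.K).thetaPilot i (placeOf (pilotDataOfK T.D T.K) pp.1 x)) *
          logNorm T.K (placeOf (pilotDataOfK T.D T.K) pp.1 x) / localDegree T.K (placeOf (pilotDataOfK T.D T.K) pp.1 x))
      (_htq : ∀ (pp : Nat.Primes) (x : (thetaIndex (pilotDataOfK T.D T.K)).Fibre (.inr pp)),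
        haveI : Fact (pp : ℕ).Prime := ⟨pp.2⟩
        Real.log ‖tq pp x‖ = -((pilotDataOfK T.D T.K).qPilot (placeOf (pilotDataOfK T.D T.K) pp.1 x)) *
          logNorm T.K (placeOf (pilotDataOfK T.D T.K) pp.1 x) / localDegree T.K (placeOf (pilotDataOfK T.D T.K) pp.1 x)),
      ¬ Thm311ToCor312.Licence
        (settingPrVolSharp (pilotDataOfK T.D T.K) hlog M archPk archSub Ψ act Mmod region n lat sig split qData tq t htq0 htq1) := by
  letI := T.instFieldF; letI := T.instNumberFieldF; letI := T.instAlgebraF; letI := T.instFieldK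
  letI := T.instNumberFieldK; letI := T.instAlgebraK; letI := T.instFieldFbar; letI := T.instAlgebraFbar
  letI := T.instAlgebraKFbar; letI := T.instIsElliptic
  intro logv hlog M _ _ archPk archSub Ψ act Mmod region n HT LogLink IsFull lat Frd IsoF Ob realify Strip
    IsoS Mv _ sig split ObΔ N _ qData tq t htq0 htq1 ht0 ht htq
  have hp : Nat.Prime 7 := by norm_num
  have hodd : Odd l := hl.odd_of_ne_two (by omega)
  have hfac : (5 ^ 14 * 19 * (2 ^ 5 * 3 * 7 ^ 13) * (11 ^ 7 * 37 ^ 2 * 353)).factorization ((⟨7, hp⟩ : Nat.Primes) : ℕ) = 13 := by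
    have hn : 5 ^ 14 * 19 * (2 ^ 5 * 3 * 7 ^ 13) * (11 ^ 7 * 37 ^ 2 * 353) = 7 ^ 13 * 104841166478316210937500000 := by norm_num
    have hm : ¬ 7 ∣ 104841166478316210937500000 := by norm_num
    show (5 ^ 14 * 19 * (2 ^ 5 * 3 * 7 ^ 13) * (11 ^ 7 * 37 ^ 2 * 353)).factorization 7 = 13
    rw [hn, Nat.factorization_mul (pow_ne_zero _ hp.ne_zero) (by norm_num), Finsupp.add_apply, hp.factorization_pow,
      Finsupp.single_eq_same, Nat.factorization_eq_zero_of_not_dvd hm, add_zero]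
  -- the sub-class `e ∣ 15·l` is the exact type `e = 15·l` (class lemma)
  have hloc' : letI := T.instFieldF; letI := T.instNumberFieldF; letI := T.instAlgebraF; letI := T.instFieldK
      letI := T.instNumberFieldK; letI := T.instAlgebraK; letI := T.instFieldFbar; letI := T.instAlgebraFbar
      letI := T.instAlgebraKFbar; letI := T.instIsElliptic
      haveI : Fact (Nat.Prime 7) := ⟨hp⟩
      ∀ x₀ : (thetaIndex (pilotDataOfK T.D T.K)).Fibre (.inr ⟨7, hp⟩),
        absRamificationIdx 7 (kOf (pilotDataOfK T.D T.K) 7 x₀) = 15 * l := by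
    intro x₀
    obtain ⟨A, hA, hA30, hA15, hAev, hA3, hA5, -⟩ := WRow.localType_class_triple_sharp isABCTriple_frey115966796875 T ⟨7, hp⟩ (by norm_num) (by norm_num)
      (by norm_num) (show (7 : ℕ) ≠ l by omega) (by norm_num) hfac x₀
    have hdiv : A * l ∣ 15 * l := hA ▸ hloc x₀
    have hAd : A ∣ 15 := Nat.dvd_of_mul_dvd_mul_right (by omega) hdiv
    have hAeq : A = 15 := by
      have hA31 : A ≤ 30 := Nat.le_of_dvd (by norm_num) hA30
      interval_cases A <;> omega
    rw [hA, hAeq]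
  have hP : 15 * l * (5 ^ 14 * 19 * (2 ^ 5 * 3 * 7 ^ 13) * (11 ^ 7 * 37 ^ 2 * 353)).factorization ((⟨7, hp⟩ : Nat.Primes) : ℕ) = l * (15 * 13) := by
    rw [hfac]; ring
  clear hfac
  have hpe : ¬ (7 : ℕ) ∣ 15 * l := by
    intro h
    rcases (Nat.Prime.dvd_mul hp).mp h with h1 | h1
    · revert h1; norm_num
    · exact hne ((Nat.prime_dvd_prime_iff_eq hp hl).mp h1).symm
  obtain ⟨a₀, h1, h2, h3⟩ := RefBand.typecells_115966796875_fifteen hlo hhi hodd (i := (l - 1) / 2 - 1) (by omega)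
  exact WRow.not_licence_triple_of_not_hullCell isABCTriple_frey115966796875 T ⟨7, hp⟩ (by norm_num) (show (7 : ℕ) ≠ l by omega)
    (by norm_num) (e₀ := 15 * l) (P := 15 * 13) (i := (l - 1) / 2 - 1) (a₀ := a₀) hpe hloc' hP (by omega) h1 h2 h3
    hlog M archPk archSub Ψ act Mmod region n lat sig split qData tq t htq0 htq1 ht0 ht htq

/-- **PER-TYPE REF band in the W-lane row shape** (chosen realising ideles, pinned reading, every free binder): the triple `5 ^ 14 * 19 + 2 ^ 5 * 3 * 7 ^ 13 = 11 ^ 7 * 37 ^ 2 * 353`,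
sub-class `e(·∣7) ∣ 15·l`, every prime `7 ≤ l ≤ 11735`, `l ≠ 7` ⇒ `¬ Cor312Vol.PilotKummerCompatHull …`.
[cite: Mochizuki2012, IUTchIII Cor. 3.12 Step (xi-f) p. 184] [claim: Mochizuki2012, status: disputed] -/
theorem GenuineK.not_pilotKummerCompatHull_chosen_triple_115966796875_typeband_of_fifteen {l : ℕ} (hl : l.Prime) (hlo : 7 ≤ l) (hhi : l ≤ 11735)
    (hne : l ≠ 7) (T : Cor22.ThetaVolumeDatumAt (ratPoint (((5 ^ 14 * 19 : ℕ) : ℚ) / (11 ^ 7 * 37 ^ 2 * 353 : ℕ))) l)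
    (hloc : letI := T.instFieldF; letI := T.instNumberFieldF; letI := T.instAlgebraF; letI := T.instFieldK
      letI := T.instNumberFieldK; letI := T.instAlgebraK; letI := T.instFieldFbar; letI := T.instAlgebraFbar
      letI := T.instAlgebraKFbar; letI := T.instIsElliptic
      haveI : Fact (Nat.Prime 7) := ⟨by norm_num⟩
      ∀ x₀ : (thetaIndex (pilotDataOfK T.D T.K)).Fibre (.inr ⟨7, by norm_num⟩),
        absRamificationIdx 7 (kOf (pilotDataOfK T.D T.K) 7 x₀) ∣ 15 * l) :
    letI := T.instFieldF; letI := T.instNumberFieldF; letI := T.instAlgebraF; letI := T.instFieldK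
    letI := T.instNumberFieldK; letI := T.instAlgebraK; letI := T.instFieldFbar; letI := T.instAlgebraFbar
    letI := T.instAlgebraKFbar; letI := T.instIsElliptic
    ∀ (M : Type) [Field M] [NumberField M]
      (archPk : ∀ (j : (thetaIndex (pilotDataOfK T.D T.K)).Label) (vQ : (thetaIndex (pilotDataOfK T.D T.K)).VQ),
        Set ((logShellsDH (pilotDataOfK T.D T.K) (analyticLogv T.K)).Packet j vQ))
      (archSub : ∀ (j : (thetaIndex (pilotDataOfK T.D T.K)).Label) (v : (thetaIndex (pilotDataOfK T.D T.K)).V),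
        Set ((logShellsDH (pilotDataOfK T.D T.K) (analyticLogv T.K)).Packet j ((thetaIndex (pilotDataOfK T.D T.K)).over v)))
      (Ψ : ℤ → ∀ v : (thetaIndex (pilotDataOfK T.D T.K)).V, v ∈ (thetaIndex (pilotDataOfK T.D T.K)).Vbad →
        Set ((logShellsDH (pilotDataOfK T.D T.K) (analyticLogv T.K)).StarPacket v))
      (act : ℤ → ∀ v : (thetaIndex (pilotDataOfK T.D T.K)).V, v ∈ (thetaIndex (pilotDataOfK T.D T.K)).Vbad →
        (logShellsDH (pilotDataOfK T.D T.K) (analyticLogv T.K)).StarPacket v →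
          Module.End ℚ ((logShellsDH (pilotDataOfK T.D T.K) (analyticLogv T.K)).StarPacket v))
      (Mmod : ℤ → ∀ j : (thetaIndex (pilotDataOfK T.D T.K)).LabelStar,
        Set ((logShellsDH (pilotDataOfK T.D T.K) (analyticLogv T.K)).GlobalPacket j.1))
      (region : ℤ → ∀ j : (thetaIndex (pilotDataOfK T.D T.K)).LabelStar, FinDivisor M →
        ∀ vQ : (thetaIndex (pilotDataOfK T.D T.K)).VQ, Set ((logShellsDH (pilotDataOfK T.D T.K) (analyticLogv T.K)).Packet j.1 vQ))
      (frobAdm : ℤ → ℤ → ∀ (j : (thetaIndex (pilotDataOfK T.D T.K)).Label) (vQ : (thetaIndex (pilotDataOfK T.D T.K)).VQ),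
        Set ((logShellsDH (pilotDataOfK T.D T.K) (analyticLogv T.K)).Packet j vQ) → Prop)
      (frobLogvol : ℤ → ℤ → ∀ (j : (thetaIndex (pilotDataOfK T.D T.K)).Label) (vQ : (thetaIndex (pilotDataOfK T.D T.K)).VQ),
        Set ((logShellsDH (pilotDataOfK T.D T.K) (analyticLogv T.K)).Packet j vQ) → ℝ)
      (frobΨ : ℤ → ℤ → ∀ v : (thetaIndex (pilotDataOfK T.D T.K)).V, v ∈ (thetaIndex (pilotDataOfK T.D T.K)).Vbad →
        Set ((logShellsDH (pilotDataOfK T.D T.K) (analyticLogv T.K)).StarPacket v))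
      (frobMmod : ℤ → ℤ → ∀ j : (thetaIndex (pilotDataOfK T.D T.K)).LabelStar,
        Set ((logShellsDH (pilotDataOfK T.D T.K) (analyticLogv T.K)).GlobalPacket j.1))
      (unitImage : ℤ → ℤ → ℕ → ∀ (j : (thetaIndex (pilotDataOfK T.D T.K)).Label) (vQ : (thetaIndex (pilotDataOfK T.D T.K)).VQ),
        Set ((logShellsDH (pilotDataOfK T.D T.K) (analyticLogv T.K)).Packet j vQ))
      (ballImage : ℤ → ℤ → ∀ (j : (thetaIndex (pilotDataOfK T.D T.K)).Label) (vQ : (thetaIndex (pilotDataOfK T.D T.K)).VQ),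
        Set ((logShellsDH (pilotDataOfK T.D T.K) (analyticLogv T.K)).Packet j vQ))
      (thetaDiv : ℤ → ℤ → LgpDivisor M (thetaIndex (pilotDataOfK T.D T.K)).lstar)
      (n : ℤ) {HT : Type} {LogLink : HT → HT → Type} {IsFull : ∀ {s t : HT}, LogLink s t → Prop}
      (lat : LGPGaussianLogThetaLattice LogLink IsFull)
      {Frd : Type} {IsoF : Frd → Frd → Type} {Ob : Frd → Type} {realify : Frd → Frd} {Strip : Type}
      {IsoS : Strip → Strip → Type} {Mv : ∀ v : (thetaIndex (pilotDataOfK T.D T.K)).V, v ∈ (thetaIndex (pilotDataOfK T.D T.K)).Vbad → Type}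
      [∀ v h, Monoid (Mv v h)]
      (sig : GlobalLGPFrobenioidSignature (thetaIndex (pilotDataOfK T.D T.K)).lstar (thetaIndex (pilotDataOfK T.D T.K)).V
        (· ∈ (thetaIndex (pilotDataOfK T.D T.K)).Vbad) Frd IsoF Ob realify Strip IsoS Mv)
      (split : SplittingMonoids Mv) {ObΔ : Type}
      {N : ∀ v : (thetaIndex (pilotDataOfK T.D T.K)).V, v ∈ (thetaIndex (pilotDataOfK T.D T.K)).Vbad → Type}
      [∀ v h, Monoid (N v h)] (qData : QPilotData ObΔ N)
      (qK : ∀ v : (thetaIndex (pilotDataOfK T.D T.K)).V, v ∈ (thetaIndex (pilotDataOfK T.D T.K)).Vbad →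
        Set ((logShellsDH (pilotDataOfK T.D T.K) (analyticLogv T.K)).StarPacket v)),
    ¬ Cor312Vol.PilotKummerCompatHull
        (LatticeSituation.ofShells (logShellsDH (pilotDataOfK T.D T.K) (analyticLogv T.K)) M archPk archSub
          (summandPiecesPr (pilotDataOfK T.D T.K) (logvAnalytic_analyticLogv (F := T.K))).Adm
          (summandPiecesPr (pilotDataOfK T.D T.K) (logvAnalytic_analyticLogv (F := T.K))).logvol Ψ act Mmod region frobAdm
          frobLogvol frobΨ frobMmod unitImage ballImage thetaDiv)
        (settingPrVolSharp (pilotDataOfK T.D T.K) (logvAnalytic_analyticLogv (F := T.K)) M archPk archSub Ψ act Mmod region n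
          lat sig split qData (exists_realising_qIdeles_pilotDataOfK T.D).choose (exists_realising_thetaIdeles_pilotDataOfK T.D).choose
          (exists_realising_qIdeles_pilotDataOfK T.D).choose_spec.1 (exists_realising_qIdeles_pilotDataOfK T.D).choose_spec.2.1)
        (fun _ => Cor312.Setting.qRegion
          (settingPrVolSharp (pilotDataOfK T.D T.K) (logvAnalytic_analyticLogv (F := T.K)) M archPk archSub Ψ act Mmod region n
            lat sig split qData (exists_realising_qIdeles_pilotDataOfK T.D).choose (exists_realising_thetaIdeles_pilotDataOfK T.D).choose
            (exists_realising_qIdeles_pilotDataOfK T.D).choose_spec.1 (exists_realising_qIdeles_pilotDataOfK T.D).choose_spec.2.1))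
        qK := by
  letI := T.instFieldF; letI := T.instNumberFieldF; letI := T.instAlgebraF; letI := T.instFieldK
  letI := T.instNumberFieldK; letI := T.instAlgebraK; letI := T.instFieldFbar; letI := T.instAlgebraFbar
  letI := T.instAlgebraKFbar; letI := T.instIsElliptic
  intro M _ _ archPk archSub Ψ act Mmod region frobAdm frobLogvol frobΨ frobMmod
    unitImage ballImage thetaDiv n HT LogLink IsFull lat Frd IsoF Ob realify Strip IsoS Mv _ sig split ObΔ N _ qData qK hSH
  have hL := licence_of_pilotKummerCompatHull (hq := fun _ _ => rfl) (hc := hSH)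
  exact WRow.not_licence_triple_115966796875_typeband_of_fifteen hl hlo hhi hne T hloc (logvAnalytic_analyticLogv (F := T.K)) M archPk archSub Ψ act Mmod
    region n lat sig split qData (exists_realising_qIdeles_pilotDataOfK T.D).choose (exists_realising_thetaIdeles_pilotDataOfK T.D).choose
    (exists_realising_qIdeles_pilotDataOfK T.D).choose_spec.1 (exists_realising_qIdeles_pilotDataOfK T.D).choose_spec.2.1
    (exists_realising_thetaIdeles_pilotDataOfK T.D).choose_spec.1 (exists_realising_thetaIdeles_pilotDataOfK T.D).choose_spec.2.2
    (exists_realising_qIdeles_pilotDataOfK T.D).choose_spec.2.2 hL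

end Summit.ABC.IUTFork.Conditional

end
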